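import Literature.AlgebraicGeometry.HodgeTheory.PicardLefschetzNodalForms
import Literature.AlgebraicGeometry.HodgeTheory.UniversalHypersurfaceDiscriminant
import Literature.AlgebraicGeometry.Motives.UniversalHypersurfaceTotalSpaceOverProper
import Literature.AlgebraicGeometry.Motives.UniversalHypersurfaceRegularLocusChart
import Literature.AlgebraicGeometry.Motives.UniversalHypersurfaceRegularLocusChartFunction
import Literature.AlgebraicGeometry.Motives.UniversalHypersurfaceRegularLocusChartPartial
import Literature.AlgebraicGeometry.Motives.UniversalHypersurfaceRegularLocusFlow
import Literature.AlgebraicGeometry.Motives.UniversalHypersurfaceRegularLocusSubmersion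
import HarnessLib

/-!
# The node neighbourhood of a uninodal form in `𝒴(ℂ)`, the cut-off scalar, and the complete flows of the cut-off lifted fields

Family `hodge`, layer `Literature/AlgebraicGeometry/HodgeTheory`. Written by the prover seat `hodge-nonav-prover-Bx` (g15, cell
`hodge-nonav`) as a brick of the ODP-ISOTOPY port (memo `PROGRAMME-ODP-ISOTOPY-Bx-g13` §2; Picard–Lefschetz binder hPL₁
`picardLefschetz_oneNode` of crux K1-B, stmt-HodgeConjecture-19716): the generalisation of prover-Ax's
`CyclicCoverPencilNodeNeighbourhood` and `CyclicCoverPencilCutoffFlows` (steps A1b-γ(iii-b), (iii-b-3) for the quaternary cyclic pencil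
`x₃^p = f₁ + c·x₂^p`, node `[0:0:1:0]`) to an ARBITRARY degree-`d` form `F` in `n + 2` variables with exactly one node `[p]`
(`IsNodalFormWithNodes F ![p]`), read in a chart `xᵢ ≠ 0` containing the node (`p i ≠ 0`), on the regular locus `𝒴°(ℂ)` of the
universal family (`Motives/UniversalHypersurfaceRegularLocus*`, generic in `(n, d, i)`).

* §1 The NODE NEIGHBOURHOOD `N_η(y₀) ⊆ 𝒴(ℂ)`: homogeneous coordinates in the chart `xᵢ ≠ 0` with affine coordinates within `η` of
  `y₀` — `nodeNbhd`, `isOpen_nodeNbhd`, `mem_nodeNbhd_of_hypersurfacePoint_eq_mk`, `map_mem_nodeNbhd_iff`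
  (for `Q ∈ 𝒴°(ℂ)`: `ι(Q) ∈ N_η(y₀) ↔ Q ∈ 𝒴°(ℂ)ᵢ ∧ ‖y(Q) − y₀‖ < η`);
* §2 `hypersurfacePoint_eq_mk_of_singular` — **a fibre-singular point of `𝒴(ℂ)` over the coefficient vector of a uninodal form `F`
  IS the node** (Jacobian criterion `mem_range_map_regularToTotalSpaceOver_iff` + the third clause of `IsNodalFormWithNodes`);
  `exists_coeff_nhds_singular_subset_nodeNbhd` — by properness (`Motives/UniversalHypersurfaceTotalSpaceOverProper`) an open
  `V ∋ coeffs F` over which all fibre-singular points lie in `N_η(y₀)`, `y₀` the affine coordinates of the node;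
  `isCompact_supportRegion` — `{Q ∈ 𝒴°(ℂ) | b(Q) ∈ K, ι(Q) ∉ N}` is compact for compact `K ⊆ V`;
* §3 The CUT-OFF SCALAR `f = (1 − λ)·χ'(b)`, `λ = regChartExtend n d i (β ∘ y)` (`β ≡ 1` on `‖y − y₀‖ < η`, zero for `‖y‖ > R`),
  `χ'` vanishing off `K`: `cutoffScalar`, `contMDiff_cutoffScalar`, `cutoffScalar_eq_zero_of_not_mem`, `cutoffScalar_eq_of`;
  `exists_cutoff_globalFlow` — **for every `C^∞` vector field `X` on `𝒴°(ℂ)` the field `f • X` has a COMPLETE `C^∞` flow**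
  (`Motives/UniversalHypersurfaceRegularLocusFlow`).

Everything is proved; the two definitions are concrete; no named facts. Honest scope: plumbing of the classical construction of the
geometric monodromy of a pencil of hypersurfaces near an ordinary double point; nothing here says HC or any rung is proved.

## References

* [VoisinHodgeII2003] C. Voisin, Hodge Theory and Complex Algebraic Geometry II (2003), §2.3.1–§2.3.2 (Lefschetz pencils, the
  universal hypersurface and its nodes).
* [LeeSmoothManifolds2013] J. M. Lee, Introduction to Smooth Manifolds (2013), Thm. 9.16 (compactly supported fields are complete),
  Lemma 2.26 (bump functions).
* [ArnoldGuseinzadeVarchenko2012] V. I. Arnold, S. M. Gusein-Zade, A. N. Varchenko, Singularities of Differentiable Maps II (2012),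
  Part I §2.1 (the monodromy field is cut off near the critical point).
-/

noncomputable section

open CategoryTheory AlgebraicGeometry MvPolynomial TopologicalSpace Set Topology
open scoped Manifold ContDiff LinearAlgebra.Projectivization
open Literature.AlgebraicGeometry.Motives Literature.AlgebraicGeometry.Motives.UniversalHypersurface
open Literature.AlgebraicGeometry.HodgeTheory.UniversalHypersurface Literature.NumberTheory.Transcendental

namespace Literature.AlgebraicGeometry.HodgeTheory

namespace NodalPencil

variable (n d : ℕ) (i : Fin (n + 2)) (y₀ : Fin (n + 1) → ℂ) (η : ℝ)

/-! ### §1 The node neighbourhood -/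

/-- **The node neighbourhood `N_η(y₀) ⊆ 𝒴(ℂ)`**: homogeneous coordinates in the chart `xᵢ ≠ 0` with affine coordinates within `η`
of `y₀`. [cite: VoisinHodgeII2003, §2.3.1] -/
def nodeNbhd : Set (ComplexPoints (totalSpaceOver ℂ n d)) :=
  {P | hypersurfacePoint (totalOverToProjectiveSpace ℂ n d) P ∈ (Projectivization.stdChart (𝕜 := ℂ) i).source ∧
    ‖Projectivization.stdChart (𝕜 := ℂ) i (hypersurfacePoint (totalOverToProjectiveSpace ℂ n d) P) - y₀‖ < η}

/-- `N_η(y₀)` is open. [cite: VoisinHodgeII2003, §2.3.1] -/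
theorem isOpen_nodeNbhd : IsOpen (nodeNbhd n d i y₀ η) := by
  have hc := continuous_hypersurfacePoint (totalOverToProjectiveSpace ℂ n d)
  have hopen : IsOpen {q : ℙ ℂ (Fin (n + 2) → ℂ) | q ∈ (Projectivization.stdChart (𝕜 := ℂ) i).source ∧
      ‖Projectivization.stdChart (𝕜 := ℂ) i q - y₀‖ < η} := by
    have h := (Projectivization.stdChart (𝕜 := ℂ) i).continuousOn.isOpen_inter_preimage
      (Projectivization.stdChart (𝕜 := ℂ) i).open_source (Metric.isOpen_ball (x := y₀) (ε := η))
    convert h using 1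
    ext q
    simp [Metric.mem_ball, dist_eq_norm]
  exact hopen.preimage hc

/-- A point of `𝒴(ℂ)` whose homogeneous coordinates are `[p]`, `p i ≠ 0`, lies in `N_η(y₀)` for `y₀ = (p_{i.succAbove j} / p_i)_j` the
affine coordinates of `[p]` (`η > 0`). [cite: VoisinHodgeII2003, §2.3.1] -/
theorem mem_nodeNbhd_of_hypersurfacePoint_eq_mk (hη : 0 < η) {p : Fin (n + 2) → ℂ} (hp : p ≠ 0) (hpi : p i ≠ 0)
    (hy₀ : y₀ = fun j => p (i.succAbove j) / p i) {P : ComplexPoints (totalSpaceOver ℂ n d)}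
    (hP : hypersurfacePoint (totalOverToProjectiveSpace ℂ n d) P = Projectivization.mk ℂ p hp) :
    P ∈ nodeNbhd n d i y₀ η := by
  refine ⟨?_, ?_⟩
  · rw [hP, Projectivization.stdChart_source, Projectivization.mk_mem_stdChartSource_iff]
    exact hpi
  · rw [hP, Projectivization.stdChart_apply, Projectivization.stdChartFun_mk, hy₀, sub_self, norm_zero]
    exact hη

/-- **For `Q ∈ 𝒴°(ℂ)`: `ι(Q) ∈ N_η(y₀) ↔ Q ∈ 𝒴°(ℂ)ᵢ ∧ ‖y(Q) − y₀‖ < η`.** [cite: VoisinHodgeII2003, §2.3.1] -/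
theorem map_mem_nodeNbhd_iff (Q : ComplexPoints (regularTotal ℂ n d)) :
    AlgPoints.map (regularToTotalSpaceOver ℂ n d) Q ∈ nodeNbhd n d i y₀ η ↔
      Q ∈ regChartDom n d i ∧ ‖(fun j => regChartFun n d i Q (Sum.inr j)) - y₀‖ < η := by
  unfold nodeNbhd
  rw [Set.mem_setOf_eq, hypersurfacePoint_map_regularToTotalSpaceOver, regChartDom_eq_preimage, Set.mem_preimage]
  rfl

/-! ### §2 The singular points over the coefficient vector of a uninodal form; the compact support region -/

variable {n d i}

/-- **A fibre-singular point of `𝒴(ℂ)` over the coefficient vector of a uninodal form is the node**: if `F` is homogeneous of degree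
`d` with `IsNodalFormWithNodes F ![p]`, `P ∉ 𝒴°(ℂ)` and `b(P) = coeffs F`, then `[z](P) = [p]`.
[cite: VoisinHodgeII2003, §2.3.1] -/
theorem hypersurfacePoint_eq_mk_of_singular {F : MvPolynomial (Fin (n + 2)) ℂ} (hF : F.IsHomogeneous d) {p : Fin (n + 2) → ℂ}
    (hFp : IsNodalFormWithNodes F ![p]) {P : ComplexPoints (totalSpaceOver ℂ n d)}
    (hP : P ∉ Set.range (AlgPoints.map (regularToTotalSpaceOver ℂ n d) :
      ComplexPoints (regularTotal ℂ n d) → ComplexPoints (totalSpaceOver ℂ n d)))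
    (hb : tCoeff ℂ n d P = coeffsOf n d F) :
    hypersurfacePoint (totalOverToProjectiveSpace ℂ n d) P = Projectivization.mk ℂ p (hFp.1 0).ne_zero := by
  have htForm : tForm ℂ n d P = F := by
    rw [tForm_eq_formOfCoeffs, hb]
    exact formOfCoeffs_coeffsOf n d hF
  -- all partials vanish at the homogeneous coordinates
  rw [mem_range_map_regularToTotalSpaceOver_iff, not_exists] at hP
  set z := (hypersurfacePoint (totalOverToProjectiveSpace ℂ n d) P).rep with hzdef
  have hz0 : z ≠ 0 := (hypersurfacePoint (totalOverToProjectiveSpace ℂ n d) P).rep_nonzero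
  have hmk : Projectivization.mk ℂ z hz0 = hypersurfacePoint (totalOverToProjectiveSpace ℂ n d) P := Projectivization.mk_rep _
  have hpart : ∀ j : Fin (n + 2), eval z (pderiv j F) = 0 := by
    intro j
    have hj := hP j
    rw [not_not, htForm, ← hmk, Projectivization.mem_projZeroLocus_mk_iff (by
      rintro G rfl
      by_cases h0 : pderiv j F = 0
      · rw [h0]; exact MvPolynomial.isHomogeneous_zero _ _ _
      · rw [(hF.pderiv (i := j)).totalDegree h0]; exact hF.pderiv)] at hj
    simpa using hj
  obtain ⟨k, t, hzt⟩ := hFp.2.2 z hz0 hpart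
  have hk : k = 0 := Subsingleton.elim _ _
  subst hk
  have hp' : (![p] : Fin 1 → Fin (n + 2) → ℂ) 0 = p := rfl
  rw [hp'] at hzt
  have ht : t ≠ 0 := by
    rintro rfl
    exact hz0 (by rw [hzt, zero_smul])
  rw [← hmk, Projectivization.mk_eq_mk_iff]
  exact ⟨Units.mk0 t ht, by rw [hzt]; rfl⟩

variable (n d i)

/-- **An open `V ∋ coeffs F` over which every fibre-singular point lies in `N_η(y₀)`**, for a uninodal form `F` of degree `d` whose node
`[p]` has `p i ≠ 0` and affine coordinates `y₀` (`η > 0`). [cite: VoisinHodgeII2003, §2.3.1 and §2.3.2] -/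
theorem exists_coeff_nhds_singular_subset_nodeNbhd (hη : 0 < η) {F : MvPolynomial (Fin (n + 2)) ℂ} (hF : F.IsHomogeneous d)
    {p : Fin (n + 2) → ℂ} (hFp : IsNodalFormWithNodes F ![p]) (hpi : p i ≠ 0)
    (hy₀ : y₀ = fun j => p (i.succAbove j) / p i) :
    ∃ V : Set (DegIndex n d → ℂ), IsOpen V ∧ coeffsOf n d F ∈ V ∧
      ∀ P : ComplexPoints (totalSpaceOver ℂ n d),
        P ∉ Set.range (AlgPoints.map (regularToTotalSpaceOver ℂ n d) : ComplexPoints (regularTotal ℂ n d) → _) →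
          tCoeff ℂ n d P ∈ V → P ∈ nodeNbhd n d i y₀ η :=
  exists_open_nhds_singular_subset n d (isOpen_nodeNbhd n d i y₀ η) fun _ hP hPb =>
    mem_nodeNbhd_of_hypersurfacePoint_eq_mk n d i y₀ η hη (hFp.1 0).ne_zero hpi hy₀
      (hypersurfacePoint_eq_mk_of_singular hF hFp hP hPb)

/-- **The support region is compact**: for compact `K ⊆ V` with all fibre-singular points over `V` inside an open `N ⊆ 𝒴(ℂ)`,
`{Q ∈ 𝒴°(ℂ) | b(Q) ∈ K, ι(Q) ∉ N}` is compact. [cite: LeeSmoothManifolds2013, Thm. 9.16] -/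
theorem isCompact_supportRegion {N : Set (ComplexPoints (totalSpaceOver ℂ n d))} (hN : IsOpen N) {K V : Set (DegIndex n d → ℂ)}
    (hK : IsCompact K) (hKV : K ⊆ V)
    (hV : ∀ P : ComplexPoints (totalSpaceOver ℂ n d),
      P ∉ Set.range (AlgPoints.map (regularToTotalSpaceOver ℂ n d) : ComplexPoints (regularTotal ℂ n d) → _) →
        tCoeff ℂ n d P ∈ V → P ∈ N) :
    IsCompact {Q : ComplexPoints (regularTotal ℂ n d) |
      regCoeff ℂ n d Q ∈ K ∧ AlgPoints.map (regularToTotalSpaceOver ℂ n d) Q ∉ N} :=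
  isCompact_setOf_regCoeff_mem_of_forall_singular n d hK hN fun P hP hPK => hV P hP (hKV hPK)

/-! ### §3 The cut-off scalar and the complete flows -/

variable (β : (Fin (n + 1) → ℂ) → ℝ) (χ' : (DegIndex n d → ℂ) → ℝ)

/-- **The cut-off scalar** `f(Q) = (1 − λ(Q))·χ'(b(Q))`, `λ = regChartExtend n d i (β ∘ y)`. [cite: LeeSmoothManifolds2013, Lemma 2.26] -/
def cutoffScalar (Q : ComplexPoints (regularTotal ℂ n d)) : ℝ :=
  (1 - regChartExtend n d i (fun v => β (fun j => v (Sum.inr j))) Q) * χ' (regCoeff ℂ n d Q)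

/-- **The cut-off scalar is `C^∞`** (`β`, `χ'` smooth, `β` zero for `‖y‖ > R`, `d ≥ 1`). [cite: LeeSmoothManifolds2013, Lemma 2.26] -/
theorem contMDiff_cutoffScalar (hd : 0 < d) (hβ : ContDiff ℝ ∞ β) {R : ℝ} (hβR : ∀ y, R < ‖y‖ → β y = 0)
    (hχ : ContDiff ℝ ∞ χ') :
    haveI := locallyOfFiniteType_regularTotal_hom ℂ n d hd
    haveI := smoothOfRelativeDimension_regularTotal_hom ℂ n d hd
    letI := ComplexPoints.chartedSpace (regularTotal ℂ n d) (n + Fintype.card (DegIndex n d))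
    ContMDiff (𝓡 (2 * (n + Fintype.card (DegIndex n d)))) 𝓘(ℝ, ℝ) ∞ (cutoffScalar n d i β χ') := by
  haveI := locallyOfFiniteType_regularTotal_hom ℂ n d hd
  haveI := smoothOfRelativeDimension_regularTotal_hom ℂ n d hd
  letI := ComplexPoints.chartedSpace (regularTotal ℂ n d) (n + Fintype.card (DegIndex n d))
  have hlin : ContDiff ℝ ∞ (fun v : ChartIdx n d i → ℂ => (fun j : Fin (n + 1) => v (Sum.inr j))) :=
    contDiff_pi.2 fun j => contDiff_apply ℝ ℂ (Sum.inr j : ChartIdx n d i)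
  have hB : ContDiff ℝ ∞ (fun v : ChartIdx n d i → ℂ => β (fun j => v (Sum.inr j))) := hβ.comp hlin
  have hBR : ∀ v : ChartIdx n d i → ℂ, R < ‖fun j => v (Sum.inr j)‖ → β (fun j => v (Sum.inr j)) = 0 :=
    fun v hv => hβR _ hv
  have hlam := contMDiff_regChartExtend_real n d i hd (fun v => β (fun j => v (Sum.inr j))) hB hBR
  have hg : ContMDiff (𝓡 (2 * (n + Fintype.card (DegIndex n d)))) 𝓘(ℝ, DegIndex n d → ℂ) ∞ (fun Q' => regCoeff ℂ n d Q') :=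
    fun Q => contMDiffAt_regCoeff n d hd Q
  have hχg : ContMDiff (𝓡 (2 * (n + Fintype.card (DegIndex n d)))) 𝓘(ℝ, ℝ) ∞ (fun Q' => χ' (regCoeff ℂ n d Q')) :=
    hχ.contMDiff.comp hg
  exact (contMDiff_const.sub hlam).mul hχg

/-- **The cut-off scalar vanishes off the support region** `{b(Q) ∈ K, ι(Q) ∉ N_η(y₀)}` (`χ' = 0` off `K`, `β ≡ 1` on `‖y − y₀‖ < η`).
[cite: LeeSmoothManifolds2013, Thm. 9.16] -/
theorem cutoffScalar_eq_zero_of_not_mem (hβ1 : ∀ y, ‖y - y₀‖ < η → β y = 1) {K : Set (DegIndex n d → ℂ)}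
    (hχK : ∀ b, b ∉ K → χ' b = 0) (Q : ComplexPoints (regularTotal ℂ n d))
    (hQ : Q ∉ {Q : ComplexPoints (regularTotal ℂ n d) |
      regCoeff ℂ n d Q ∈ K ∧ AlgPoints.map (regularToTotalSpaceOver ℂ n d) Q ∉ nodeNbhd n d i y₀ η}) :
    cutoffScalar n d i β χ' Q = 0 := by
  rw [Set.mem_setOf_eq, not_and_or, not_not] at hQ
  rcases hQ with hK | hN
  · rw [cutoffScalar, hχK _ hK, mul_zero]
  · obtain ⟨hdom, hy⟩ := (map_mem_nodeNbhd_iff n d i y₀ η Q).mp hN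
    rw [cutoffScalar, regChartExtend_of_mem n d i _ hdom, hβ1 _ hy, sub_self, zero_mul]

/-- Where the node cut-off vanishes the cut-off scalar is `χ'(b(Q))`. [cite: LeeSmoothManifolds2013, Lemma 2.26] -/
theorem cutoffScalar_eq_of {Q : ComplexPoints (regularTotal ℂ n d)}
    (hlam0 : regChartExtend n d i (fun v => β (fun j => v (Sum.inr j))) Q = 0) :
    cutoffScalar n d i β χ' Q = χ' (regCoeff ℂ n d Q) := by
  rw [cutoffScalar, hlam0, sub_zero, one_mul]

/-- If `χ'(b(Q)) = 0` the cut-off scalar vanishes. [cite: LeeSmoothManifolds2013, Lemma 2.26] -/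
theorem cutoffScalar_eq_zero_of_chi {Q : ComplexPoints (regularTotal ℂ n d)} (hχ : χ' (regCoeff ℂ n d Q) = 0) :
    cutoffScalar n d i β χ' Q = 0 := by
  rw [cutoffScalar, hχ, mul_zero]

/-- **The complete flow of the cut-off field `f • X`.** Let `d ≥ 1`, `η > 0`, `β`/`χ'` as above with `χ'` vanishing off a compact `K`
contained in a set `V` over which all fibre-singular points lie in `N_η(y₀)` (`exists_coeff_nhds_singular_subset_nodeNbhd`), and `X` a
`C^∞` vector field on `𝒴°(ℂ)`. Then `cutoffScalar • X` has a complete `C^∞` flow with the group law, whose orbits are its integral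
curves and which fixes its zeros. [cite: LeeSmoothManifolds2013, Thm. 9.16] [cite: ArnoldGuseinzadeVarchenko2012, Part I §2.1] -/
theorem exists_cutoff_globalFlow (hd : 0 < d) (hβ : ContDiff ℝ ∞ β) {R : ℝ} (hβR : ∀ y, R < ‖y‖ → β y = 0)
    (hβ1 : ∀ y, ‖y - y₀‖ < η → β y = 1) (hχ : ContDiff ℝ ∞ χ')
    {K V : Set (DegIndex n d → ℂ)} (hK : IsCompact K) (hKV : K ⊆ V) (hχK : ∀ b, b ∉ K → χ' b = 0)
    (hV : ∀ P : ComplexPoints (totalSpaceOver ℂ n d),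
      P ∉ Set.range (AlgPoints.map (regularToTotalSpaceOver ℂ n d) : ComplexPoints (regularTotal ℂ n d) → _) →
        tCoeff ℂ n d P ∈ V → P ∈ nodeNbhd n d i y₀ η)
    (X : haveI := locallyOfFiniteType_regularTotal_hom ℂ n d hd
      haveI := smoothOfRelativeDimension_regularTotal_hom ℂ n d hd
      letI := ComplexPoints.chartedSpace (regularTotal ℂ n d) (n + Fintype.card (DegIndex n d))
      Π Q : ComplexPoints (regularTotal ℂ n d), TangentSpace (𝓡 (2 * (n + Fintype.card (DegIndex n d)))) Q)
    (hX : haveI := locallyOfFiniteType_regularTotal_hom ℂ n d hd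
      haveI := smoothOfRelativeDimension_regularTotal_hom ℂ n d hd
      letI := ComplexPoints.chartedSpace (regularTotal ℂ n d) (n + Fintype.card (DegIndex n d))
      haveI := ComplexPoints.isManifold_real (regularTotal ℂ n d) (n + Fintype.card (DegIndex n d))
      ContMDiff (𝓡 (2 * (n + Fintype.card (DegIndex n d)))) (𝓡 (2 * (n + Fintype.card (DegIndex n d)))).tangent ∞
        (fun Q => (⟨Q, X Q⟩ : TangentBundle (𝓡 (2 * (n + Fintype.card (DegIndex n d)))) (ComplexPoints (regularTotal ℂ n d))))) :
    haveI := locallyOfFiniteType_regularTotal_hom ℂ n d hd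
    haveI := smoothOfRelativeDimension_regularTotal_hom ℂ n d hd
    letI := ComplexPoints.chartedSpace (regularTotal ℂ n d) (n + Fintype.card (DegIndex n d))
    ∃ θ : ℝ × ComplexPoints (regularTotal ℂ n d) → ComplexPoints (regularTotal ℂ n d),
      ContMDiff (𝓘(ℝ, ℝ).prod (𝓡 (2 * (n + Fintype.card (DegIndex n d))))) (𝓡 (2 * (n + Fintype.card (DegIndex n d)))) ∞ θ ∧
      (∀ Q, θ (0, Q) = Q) ∧ (∀ t s Q, θ (t, θ (s, Q)) = θ (t + s, Q)) ∧
      (∀ Q, IsMIntegralCurve (fun t => θ (t, Q)) (fun Q' => cutoffScalar n d i β χ' Q' • X Q')) ∧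
      ∀ Q, cutoffScalar n d i β χ' Q • X Q = 0 → ∀ t, θ (t, Q) = Q :=
  exists_globalFlow_smul_of_isCompact n d hd X (cutoffScalar n d i β χ') hX (contMDiff_cutoffScalar n d i β χ' hd hβ hβR hχ)
    (isCompact_supportRegion n d (isOpen_nodeNbhd n d i y₀ η) hK hKV hV)
    (fun Q hQ => cutoffScalar_eq_zero_of_not_mem n d i y₀ η β χ' hβ1 hχK Q hQ)

end NodalPencil

end Literature.AlgebraicGeometry.HodgeTheory

end
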